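import Mathlib
import Literature.MathematicalPhysics.StatisticalMechanics.Crystallization

/-!
# Strained-margin certificate for the near/far split of `TruncatedCensusGap` — definitions

Route `PricedLinkCensus`, crux `TruncatedCensusGap` (stmt-AtomisticToContinuum-14230), line
`near-far-split`, registered stub `stub_strainedMarginCert` (N1b, reshape r1 of lead c5): on the
strained part of the near-window — `a ∈ [0.93, 1.02]`, `h ∈ [0.78a, 0.808a] ∪ [0.825a, 0.86a]` —
both affine endpoints `F_fcc(a,h) = e₀` and `F_hcp(a,h) = e₀ + J₂` of the `V_χ` energy per
particle of a Barlow stacking (explicit finite class sums of `V_χ = min 1 (max 0 (4−2r)) · V_LJ`)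
sit `≥ μ > 0` above the reference value `F_hcp(0.977, 0.797) ≥ e_χ*`.

This file contains the COMPUTABLE data of the certificate — a rational box checker — and its
kernel run `certificate_eq_true` (`decide +kernel`); the soundness of the checker is proved in
`…StrainedMarginCertAnalysis` (the functions `L`, `g`, cut-off, square-root brackets, line
minorants) and `…StrainedMarginCertChecker` (boxes, bisection), and the registered stub
`stub_strainedMarginCert` is assembled in `…StrainedMarginCert`.  Variables: `u = a²`, `t = (h/a)²`; every squared distance of
the ten distance classes is `w = u (P + K t)` and every class term is `g(w) = V_χ(√w)
= χ(√w) · L(w)`, `L(w) = w⁻⁶/12 − w⁻³/6`.  Per box and class the checker produces a line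
`ℓ(w) = b w + c ≤ g(w)` on the class's `w`-range (`cvx`: tangent of `L` at the midpoint where
`L'' ≥ 0`, i.e. `w³ ≤ 7/4`; `ccv`: secant of the concave minorant `χ̄ · L`, `χ̄` the chord of the
convex `χ₊ = max 0 (4 − 2√·)` through rational over-estimates, where `w³ ≥ 7/4` and the range does
not straddle the kink `w = 9/4`; `mono`: the constant `L(w₁)` where `1 ≤ w₁ ≤ 9/4`; else the floor
`−1/12`), sums the lines (positive multiplicities) into a function bilinear in `(u, t)` and compares
its four corner values with the threshold `THR`; failing boxes are bisected (fuel `9`; 122 boxes are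
visited).  Square roots enter only through validated rational brackets (`sqrtLo² ≤ x ≤ sqrtHi²`).
-/

namespace Summit.AtomisticToContinuum.Crystallization.Theorems.PricedLinkCensusTruncatedCensusGap.StrainedMargin

/-! ## The potential along a distance class -/

/-- `L(w) = w⁻⁶/12 − w⁻³/6 = V_LJ(√w)` over `ℚ`. [folklore] -/
def Lq (w : ℚ) : ℚ := (w ^ 6)⁻¹ / 12 - (w ^ 3)⁻¹ / 6

/-- `L'(w) = w⁻⁴/2 − w⁻⁷/2` over `ℚ`. [folklore] -/
def Lpq (w : ℚ) : ℚ := (w ^ 4)⁻¹ / 2 - (w ^ 7)⁻¹ / 2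

/-! ## Validated rational square-root brackets -/

/-- Newton iteration for the integer square root (structural recursion on the fuel; the result is
only used after validation). [folklore] -/
def sqrtIter : ℕ → ℕ → ℕ → ℕ
  | 0, _, g => g
  | f + 1, n, g => if g = 0 then 0 else if (g + n / g) / 2 < g then sqrtIter f n ((g + n / g) / 2) else g

/-- Integer square-root candidate. [folklore] -/
def isqrtC (n : ℕ) : ℕ := sqrtIter 200 n (n + 1)

/-- Denominator of the square-root brackets (`10⁹`). [folklore] -/
def SQD : ℕ := 1000000000

/-- A rational `s ≥ 0` with `s² ≤ x` (validated; `0` otherwise). [folklore] -/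
def sqrtLo (x : ℚ) : ℚ :=
  if (isqrtC (⌊x * (SQD : ℚ) ^ 2⌋).toNat : ℚ) / SQD * ((isqrtC (⌊x * (SQD : ℚ) ^ 2⌋).toNat : ℚ) / SQD) ≤ x
  then (isqrtC (⌊x * (SQD : ℚ) ^ 2⌋).toNat : ℚ) / SQD else 0

/-- A rational `t ≥ 0` with `x ≤ t²`, for `x ≥ 0` (validated; `x + 1` otherwise). [folklore] -/
def sqrtHi (x : ℚ) : ℚ :=
  if x ≤ ((isqrtC (⌊x * (SQD : ℚ) ^ 2⌋).toNat + 1 : ℕ) : ℚ) / SQD * (((isqrtC (⌊x * (SQD : ℚ) ^ 2⌋).toNat + 1 : ℕ) : ℚ) / SQD)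
  then ((isqrtC (⌊x * (SQD : ℚ) ^ 2⌋).toNat + 1 : ℕ) : ℚ) / SQD else x + 1

/-- Over-estimate of the cut-off `χ(√w) = min 1 (max 0 (4 − 2√w))`: `1` up to the kink `w = 9/4`,
`max 0 (4 − 2 sqrtLo w)` beyond. [folklore] -/
def chiHi (w : ℚ) : ℚ := if w ≤ 9 / 4 then 1 else max 0 (4 - 2 * sqrtLo w)

/-- Under-estimate of the cut-off: `1` up to the kink, `max 0 (4 − 2 sqrtHi w)` beyond. [folklore] -/
def chiLo (w : ℚ) : ℚ := if w ≤ 9 / 4 then 1 else max 0 (4 - 2 * sqrtHi w)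

/-- Upper bound of `g(w) = χ(√w) L(w)` for `w ≥ 1` (where `L ≤ 0`). [folklore] -/
def gHi (w : ℚ) : ℚ := chiLo w * Lq w

/-! ## The line minorant of a class on a `w`-range -/

/-- The line `b w + c` produced for the range `[w₁, w₂]` (as the pair `(b, c)`). [folklore] -/
def lineLB (w₁ w₂ : ℚ) : ℚ × ℚ :=
  if w₂ ^ 3 ≤ 7 / 4 then
    -- `cvx`: tangent of `L` at the midpoint
    (Lpq ((w₁ + w₂) / 2), Lq ((w₁ + w₂) / 2) - Lpq ((w₁ + w₂) / 2) * ((w₁ + w₂) / 2))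
  else if 7 / 4 ≤ w₁ ^ 3 ∧ (w₂ ≤ 9 / 4 ∨ 9 / 4 ≤ w₁) then
    -- `ccv`: secant of `χ̄ L` through `(wᵢ, chiHi wᵢ · L wᵢ)`
    if w₁ = w₂ then (0, chiHi w₁ * Lq w₁)
    else if chiHi w₂ ≤ chiHi w₁ then
      ((chiHi w₂ * Lq w₂ - chiHi w₁ * Lq w₁) / (w₂ - w₁),
        chiHi w₁ * Lq w₁ - (chiHi w₂ * Lq w₂ - chiHi w₁ * Lq w₁) / (w₂ - w₁) * w₁)
    else (0, -1 / 12)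
  else if 1 ≤ w₁ ∧ w₁ ≤ 9 / 4 then
    -- `mono`: `g` is at least `L(w₁)` to the right of `w₁ ≥ 1`
    (0, Lq w₁)
  else (0, -1 / 12)

/-! ## The two families of distance classes `(multiplicity, P, K)`, `w = u (P + K t)` -/

/-- The classes of `F_fcc = e₀`: in-layer `a, √3a, 2a`; adjacent layer; second layer
non-aligned. [folklore] -/
def FCC : List (ℚ × ℚ × ℚ) :=
  [(3, 1, 0), (3, 3, 0), (3, 4, 0), (3, 1 / 3, 1), (3, 4 / 3, 1), (6, 7 / 3, 1), (3, 1 / 3, 4), (3, 4 / 3, 4)]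

/-- The classes of `F_hcp = e₀ + J₂`: in-layer; adjacent layer; second layer aligned. [folklore] -/
def HCP : List (ℚ × ℚ × ℚ) :=
  [(3, 1, 0), (3, 3, 0), (3, 4, 0), (3, 1 / 3, 1), (3, 4 / 3, 1), (6, 7 / 3, 1), (1, 0, 4), (6, 1, 4)]

/-! ## The box checker -/

/-- The lines of a family on the box `[u₁, u₂] × [t₁, t₂]`: `(m, P, K, b, c)` per class. [folklore] -/
def boxLines (cls : List (ℚ × ℚ × ℚ)) (u₁ u₂ t₁ t₂ : ℚ) : List (ℚ × ℚ × ℚ × ℚ × ℚ) :=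
  cls.map fun c => (c.1, c.2.1, c.2.2, (lineLB (u₁ * (c.2.1 + c.2.2 * t₁)) (u₂ * (c.2.1 + c.2.2 * t₂))).1,
    (lineLB (u₁ * (c.2.1 + c.2.2 * t₁)) (u₂ * (c.2.1 + c.2.2 * t₂))).2)

/-- The value of the summed lines at a point `(u, t)`. [folklore] -/
def linesVal (ls : List (ℚ × ℚ × ℚ × ℚ × ℚ)) (u t : ℚ) : ℚ :=
  (ls.map fun l => l.1 * (l.2.2.2.1 * (u * (l.2.1 + l.2.2.1 * t)) + l.2.2.2.2)).sum

/-- The threshold: a rational just above `F_hcp(0.977, 0.797) + 1/20000`. [folklore] -/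
def THR : ℚ := -6085689 / 10000000

/-- A family passes on a box if its summed lines are `≥ THR` at the four corners. [folklore] -/
def famOK (cls : List (ℚ × ℚ × ℚ)) (u₁ u₂ t₁ t₂ : ℚ) : Bool :=
  let ls := boxLines cls u₁ u₂ t₁ t₂
  decide (THR ≤ linesVal ls u₁ t₁) && decide (THR ≤ linesVal ls u₁ t₂) &&
    decide (THR ≤ linesVal ls u₂ t₁) && decide (THR ≤ linesVal ls u₂ t₂)

/-- Both families pass on the box. [folklore] -/
def boxOK (u₁ u₂ t₁ t₂ : ℚ) : Bool := famOK FCC u₁ u₂ t₁ t₂ && famOK HCP u₁ u₂ t₁ t₂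

/-- Recursive bisection with fuel. [folklore] -/
def check : ℕ → ℚ → ℚ → ℚ → ℚ → Bool
  | 0, u₁, u₂, t₁, t₂ => boxOK u₁ u₂ t₁ t₂
  | f + 1, u₁, u₂, t₁, t₂ =>
    boxOK u₁ u₂ t₁ t₂ ||
      (check f u₁ ((u₁ + u₂) / 2) t₁ ((t₁ + t₂) / 2) && check f u₁ ((u₁ + u₂) / 2) ((t₁ + t₂) / 2) t₂ &&
        check f ((u₁ + u₂) / 2) u₂ t₁ ((t₁ + t₂) / 2) && check f ((u₁ + u₂) / 2) u₂ ((t₁ + t₂) / 2) t₂)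

/-- The reference point `(u₀, v₀) = (0.977², 0.797²)` and the upper bound of `F_hcp` there. [folklore] -/
def refHi : ℚ :=
  (HCP.map fun c => c.1 * gHi (c.2.1 * (954529 / 1000000) + c.2.2 * (635209 / 1000000))).sum

/-- THE CERTIFICATE: the two strained strips `t ∈ [0.78², 0.808²]` and `t ∈ [0.825², 0.86²]` over
`u ∈ [0.93², 1.02²]` pass with fuel `9`, and the reference bound sits `1/20000` below `THR`. [folklore] -/
def certificate : Bool :=
  decide (refHi + 1 / 20000 ≤ THR) &&
    check 9 (8649 / 10000) (10404 / 10000) (6084 / 10000) (652864 / 1000000) &&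
    check 9 (8649 / 10000) (10404 / 10000) (680625 / 1000000) (7396 / 10000)

/-! ## Real-side objects of the soundness proofs -/

/-- `L(w) = w⁻⁶/12 − w⁻³/6` over `ℝ` (`= V_LJ(√w)` for `w > 0`). [folklore] -/
noncomputable def LR (w : ℝ) : ℝ := (w ^ 6)⁻¹ / 12 - (w ^ 3)⁻¹ / 6

/-- `L'(w)` over `ℝ`. [folklore] -/
noncomputable def LRd (w : ℝ) : ℝ := (w ^ 4)⁻¹ / 2 - (w ^ 7)⁻¹ / 2

/-- `L''(w) = (7/2) w⁻⁸ − 2 w⁻⁵` over `ℝ`. [folklore] -/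
noncomputable def LRdd (w : ℝ) : ℝ := 7 / 2 * (w ^ 8)⁻¹ - 2 * (w ^ 5)⁻¹

/-- The class term `g(w) = V_χ(√w) = min 1 (max 0 (4 − 2√w)) · V_LJ(√w)`. [folklore] -/
noncomputable def gR (w : ℝ) : ℝ :=
  min 1 (max 0 (4 - 2 * Real.sqrt w)) *
    Literature.MathematicalPhysics.StatisticalMechanics.lennardJones (Real.sqrt w)

/-- The real value `Σ m · g(u (P + K t))` of a family of classes at `(u, t)`. [folklore] -/
noncomputable def famR (cls : List (ℚ × ℚ × ℚ)) (u t : ℝ) : ℝ :=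
  (cls.map fun c => (c.1 : ℝ) * gR (u * (c.2.1 + c.2.2 * t))).sum

/-- The real value of summed lines `Σ m (b · u (P + K t) + c)` at `(u, t)`. [folklore] -/
noncomputable def linesR (ls : List (ℚ × ℚ × ℚ × ℚ × ℚ)) (u t : ℝ) : ℝ :=
  (ls.map fun l => (l.1 : ℝ) * (l.2.2.2.1 * (u * (l.2.1 + l.2.2.1 * t)) + l.2.2.2.2)).sum

/-! ## The kernel run -/

/-- **THE KERNEL RUN** (registered sub-goal `certificate_eq_true`): the certificate evaluates to
`true` — 122 boxes are visited, bisection depth 5, about 30 s of kernel time. [folklore] -/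
theorem certificate_eq_true : certificate = true := by
  decide +kernel

end Summit.AtomisticToContinuum.Crystallization.Theorems.PricedLinkCensusTruncatedCensusGap.StrainedMargin
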